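import Literature.NumberTheory.EllipticCurves.Kato2004.AdditiveNoSplitTwistNegOneRankZeroShaUpperBoundPlusOneAtTwo
import HarnessLib

/-!
# Route ByReductionTypeAtTwo, crux `AdditiveRankZeroAtTwo` (stmt-BirchSwinnertonDyer-19098) — ONE typed research
# target (Theses-free, importable by the route file): the `+ 2` Kato-at-`2` bound for EVERY additive curve (step T18
# of the lane's reading; MEMO tier, nothing asserted)

Why this file exists (seat `bsd-2adic-addL2x` GEN 14, 2026-08-28; pattern of `ByReductionTypeAtTwoMultUpperHalfDefs.lean`
/ `…MultUpperHalfKatoIntDefs.lean` of lane mult-2). The lane's Kato-at-`2` readings in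
`Literature/NumberTheory/EllipticCurves/Kato2004/Additive*AtTwo*.lean` (GEN 5/8/13: T1–T17; D-audit PASS ×3, two of
them reviewed ACCEPT) cover every ADDITIVE curve at `2` with irreducible `E[2]` EXCEPT those whose twist `E^{(−1)}` is
SPLIT multiplicative at `2` (`E ≅ E_q ⊗ χ_{−1}` over `ℚ₂`; cell census: 169 of the 1 945 rank-`0` additive classes, 128
with irreducible `E[2]`), where GEN 13's T17 (a) records — without claiming it — that the same steps give the bound
with `+ 2`. The seat filed that step (T18) as a Literature named fact (p659491); the sampled reviewer REJECTED the
Literature home (rule 5b (i): a `[cite]`d `def … : Prop` is for results AS PRINTED; Kato's Thm. 14.5 (3) prints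
«`p ≠ 2`», «potentially good», (12.5.2); the `+ 2` is the seat's derived consequence — option (b) of the verdict: «file
this reading as a route thesis / target item on stmt-BirchSwinnertonDyer-19098 (a hypothesis a prover may take, not a
cited fact)»). This module is option (b): ONE `@[conjecture]` constant (nothing asserted), its docstring carrying the
derivation T18 for the cell's referee/audit lane, consumed BY NAME by the uniform Kato-half doors
(`Theorems/ByReductionTypeAtTwoUniformKatoHalfUpToTwo.lean`). It imports no Theses file.

HONEST FRAMING (cell `bsd-2adic`, HUMAN RULING D-0036/D-0054): a typed target; nothing asserted, nothing booked; BSD is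
not proved by any of this. PARTITION: X5@2 additive (−1)-split sub-block (169 classes) × p = 2 — types-the-object-of;
closes none.

## The derivation offered for audit (T18; numbering continues the Literature files' T1–T17)

Setting and notation as in `Kato2004/AdditiveNoSplitCyclotomicTwistRankZeroShaUpperBoundFineSelmerAtTwoSharp.lean` (T15,
T16) and `Kato2004/AdditiveNoSplitTwistNegOneRankZeroShaUpperBoundPlusOneAtTwo.lean` (T17): `E/ℚ` non-CM, globally
minimal `W`, ADDITIVE at `2` with `E^{(−1)}` SPLIT multiplicative at `2`, `E[2]` irreducible, `L(E,1) ≠ 0`, `Ш` finite;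
`Λ = ℤ₂[[G_∞]]`, `Λ' = ℤ₂[[X]]` (`X = γ − 1`, `γ ↔ σ₅`).
* **T18 (a).** By T16 (a)(b) (Kato (12.5.1) + 13.13 with `ψ = χ_{−1}`) the local term of Thm. 12.5 (3) for `V₂E` sits at
  `𝔭' = ker(Λ → ℤ₂, σ ↦ κ(σ)^{−1}χ_{−1}(σ))`, length `1`; `(κ^{−1}χ_{−1})(σ_{−1}) = (−1)(−1) = +1`, so `𝔭' = 𝔭₊(𝔮')` IS an
  `e₊`-prime of step T3, `𝔮' = 𝔭' ∩ Λ' = (X − a)` with `γ ↦ κ(σ₅)^{−1}χ_{−1}(σ₅) = 1/5` (`σ₅` fixes `i = ζ₄`), i.e.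
  `a = 1/5 − 1 = −4/5`, `v₂(a) = 2` (T17 (a) records this value).
* **T18 (b).** As in T17 (b): T3 at `𝔮'` carries the length-`1` local term, so `g₀ ∣ φ₀·(X − a)` in `ℤ₂[[X]]`, and Lemma
  14.15 evaluates the extra factor at `X = 0` to `|a|₂^{−1} = 4`: `#H²(ℤ[1/2],T) ≤ 4·2^{μ₂ − m}[H¹(ℤ[1/2],T) : z]`;
  T4′ (`μ₂ = r_∞` under (A): the `2`-adic local term of the limit Poitou–Tate sequence is `ℤ₂`-infinite here —
  `μ_{2^∞} ⊗ χ_{−1}` is fixed by `Gal(ℚ̄₂/ℚ₂^cyc)` — but `ℤ₂`-finitely generated, which is all T4′ uses), T7/T7′, T8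
  (`a = t − v₂(c₂)`, additive), T9 (`L_{(2)} = L`), T10, T11–T14 (`m ≥ 1`) unchanged. TOTAL:
  `ord₂ #Ш(E/ℚ)[2^∞] + Σ_ℓ v₂(c_ℓ) ≤ ord₂(L(E,1)/Ω_E) + 2`.
* **T18 (c).** Every other additive curve with irreducible `E[2]` has the bound with `+ 1` (T17's fact, hypothesis
  (NST″)) or sharp; hence `+ 2` holds for EVERY additive curve at `2` — the statement below carries NO twist hypothesis.
* **What the `4` is (R-B76, open).** `|a|₂^{−1} = 4 = #H₀(G_∞, ℤ₂(κ^{−1}χ_{−1})) = #(μ_{2^∞} ⊗ χ_{−1})^{G_{ℚ₂}} ⊆ E(ℚ₂)[2^∞]`: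
  the coinvariants of the local line; the identities of T6′/T7′ give EXACTLY `#S₁(W) = 2^{e + a − t − m}·|φ₀(0)/g₀(0)|₂`,
  so BSD₂ on this class ⟺ `ord₂ g₀(0) − ord₂ φ₀(0) = m − 1`; Kato's inequality gives only `≤ m + 1`. Whether `z'`
  itself acquires the factor `(X − a)` (so that the slack is in `φ₀`, not in `Ш`) is the successor's question; NOT
  claimed either way.

References: [Kato2004Asterisque] Thm. 12.5 (1)(3), (12.5.1) (pp. 221–222), 13.8 (pp. 227–229), 13.13 (pp. 233–234),
14.14 and Lemma 14.15 (pp. 243–244), Prop. 14.16 (2) (pp. 244–245); [Kato1999Kodai] Thm. 0.8; [SilvermanATAEC1994]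
Lemma V.5.2, Thm. V.5.3, proof of Cor. V.5.4, Ex. 5.11; [CoatesSujatha2005] statement (A); [Lim2017FineSelmer] §3;
memo `run/shared/lean/pub/bsd-2adic/addL2x/VERDICT-19098-addL2x-GEN14.md`.
-/

set_option autoImplicit false
set_option linter.dupNamespace false

noncomputable section

open scoped Classical

open WeierstrassCurve Literature.NumberTheory.EllipticCurves

namespace Summit.BirchSwinnertonDyer.BirchSwinnertonDyer.Theorems.AddKatoTwo

/-- [crux, MEMO] **The `+ 2` Kato-at-`2` bound for EVERY additive curve** — step T18 of the lane's reading (module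
docstring), a typed research TARGET (nothing asserted): for every globally minimal NON-CM `W/ℚ` with ADDITIVE reduction
at `2`, `E[2]` irreducible, `L(E,1) ≠ 0`, `Ш(E/ℚ)` finite, and statement (A) at `(E,2)` in the `∃ γ D` spelling, there is
`q ∈ ℚ` with `L(E,1)/Ω(W) = q` and `ord₂ #Ш(E/ℚ)(2) + v₂(Tam(W)) ≤ ord₂ q + 2`. Its content beyond the Literature
readings (sharp under (NST′), `+ 1` under (NST″)) is the (−1)-split class (169 census classes), where Kato's 13.13 local
term sits at the `e₊`-prime `(X + 4/5)` of `Λ'` and costs `v₂(4/5) = 2` in Lemma 14.15. Memo-derived in the cell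
(T18), NOT in print (Kato's Thm. 14.5 (3) prints `p ≠ 2`, potentially good, (12.5.2)); the sharp bound on this class is
predicted by BSD and NOT claimed. Same binders as the `+ 1` Literature fact with the twist hypothesis deleted.
[cite: Kato2004Asterisque, Thm. 12.5 (3) and (12.5.1) (p. 222), 13.13 (pp. 233–234), 14.14 and Lemma 14.15 (pp. 243–244) (shape; printed for p ≠ 2 / potentially good)]
[cite: CoatesSujatha2005, statement (A) (the hypothesis)] -/
@[conjecture] def KatoPlusTwoAtTwoAdditive : Prop :=
  ∀ (W : WeierstrassCurve ℚ) [W.IsElliptic] [W.IsGloballyMinimal], ¬ W.HasCM →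
    ¬ W.HasGoodReductionAtPrime 2 → ¬ W.HasMultiplicativeReductionAtPrime 2 →
    W.HasIrreducibleModPGaloisRep 2 →
    (∀ (κ : ZpExtension ℚ 2), κ.IsCyclotomic →
      ∃ (γ : Field.absoluteGaloisGroup ℚ) (D : W.FineSelmerDualData κ γ),
        Module.Finite ℤ_[2] (RestrictScalars ℤ_[2] (IwasawaAlgebra 2) D.X)) →
    W.entireLFunction 1 ≠ 0 → Finite W.sha →
    ∃ q : ℚ, W.entireLFunction 1 / (W.realPeriodRat : ℂ) = (q : ℂ) ∧
      (padicValNat 2 (Nat.card (AddCommGroup.primaryComponent W.sha 2)) : ℤ) +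
          padicValNat 2 W.tamagawaProduct ≤ padicValRat 2 q + 2

/-- `KatoPlusTwoAtTwoAdditive` restricted to the (NST″) curves is IMPLIED by the `+ 1` Literature reading
`Kato2004.…_le_add_one_at_two_of_noSplitTwistNegOne_…` (pure logic: `+ 1 ≤ + 2`); recorded so the planner sees
that the target's new content is the (−1)-split class only. [cite: Kato2004Asterisque, Thm. 12.5 (3) (p. 222)] -/
theorem katoPlusTwoAtTwoAdditive_onNST''_of_plusOne
    (h1 : Kato2004.rankZero_padicValNat_sha_add_padicValNat_tamagawa_le_add_one_at_two_of_noSplitTwistNegOne_of_irreducible_of_fineSelmerDual_fg) :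
    ∀ (W : WeierstrassCurve ℚ) [W.IsElliptic] [W.IsGloballyMinimal], ¬ W.HasCM →
      ¬ W.HasGoodReductionAtPrime 2 → ¬ W.HasMultiplicativeReductionAtPrime 2 →
      ¬ (W.quadraticTwist (-1)).HasSplitMultiplicativeReductionAtPrime 2 →
      W.HasIrreducibleModPGaloisRep 2 →
      (∀ (κ : ZpExtension ℚ 2), κ.IsCyclotomic →
        ∃ (γ : Field.absoluteGaloisGroup ℚ) (D : W.FineSelmerDualData κ γ),
          Module.Finite ℤ_[2] (RestrictScalars ℤ_[2] (IwasawaAlgebra 2) D.X)) →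
      W.entireLFunction 1 ≠ 0 → Finite W.sha →
      ∃ q : ℚ, W.entireLFunction 1 / (W.realPeriodRat : ℂ) = (q : ℂ) ∧
        (padicValNat 2 (Nat.card (AddCommGroup.primaryComponent W.sha 2)) : ℤ) +
            padicValNat 2 W.tamagawaProduct ≤ padicValRat 2 q + 2 := by
  intro W _ _ hcm hgood hmult hneg hirr hA hL hfin
  obtain ⟨q, hq, hle⟩ := h1 W hcm hgood hmult hneg hirr hA hL hfin
  exact ⟨q, hq, by linarith⟩

end Summit.BirchSwinnertonDyer.BirchSwinnertonDyer.Theorems.AddKatoTwo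

end
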